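import Mathlib
import Summits.Ventures.PercRepro2.HCov
import Summits.Ventures.PercRepro2.GcSkelRules
import Summits.Ventures.PercRepro2.GcSkelReductionT
import Summits.Ventures.PercRepro2.GcSkelShapeT
import Summits.Ventures.PercRepro2.GcSkelReductionMin
import Summits.Ventures.PercRepro2.GcSkelReductionO
import Summits.Ventures.PercRepro2.GcSkelReductionOB
import Summits.Ventures.PercRepro2.GcSkelReductionMinOB
import Summits.Ventures.PercRepro2.GcSkelReductionH
import Summits.Ventures.PercRepro2.GcSkelReductionMinH
import Summits.Ventures.PercRepro2.GcSkelReductionActive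
import Summits.Ventures.PercRepro2.GcSkelReductionZ

/-!
# The shape of the class of record in one statement (blind cell PercRepro2, typer-1 g56)

`shape_of_wredT` (g54) states the shape of the block-free residual; the clauses added since —
the three star classes, the pole hub, two active unmarked vertices, no edge among the roots —
each carry a shape lemma of their own. **`shape_of_wredMinHAZ`** collects them on the class of
record `WReducedMinHAZ`: simple; unmarked non-loop degrees `0` or `≥ 3`; `o, b, a₁, a₂` not leaves
and not isolated; two-connected off `a₃`; `MarksReach`; mark-free two-terminal blocks are isolated
vertices; `o` has an edge to a vertex outside `{a₁, a₂, b}` and one outside `{a₃, b}`, `b` one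
outside `{a₁, a₂, o}`; `o` or `b` has an unmarked neighbour; `a₃` has an unmarked neighbour; two
distinct unmarked vertices carry a non-loop edge; no edge joins two roots. Standard axioms.
-/

namespace Summit.Ventures.PercRepro2

open CovForm RECM SepPair

namespace WRed

section Shape

variable {V : Type*} {E : Type*} [Fintype E] [DecidableEq E] [DecidableEq V]

omit [Fintype E] [DecidableEq E] [DecidableEq V] in
/-- `a₃` has an unmarked neighbour on any instance outside class `R₃`. -/
theorem exists_unmarked_neighbour_a3_of_not_a3ToMarks {ends : E → Sym2 V} {o a₁ a₂ a₃ b : V}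
    (h : ¬ A3RECM.A3ToMarks ends o a₁ a₂ a₃ b) :
    ∃ (e : E) (x : V), ends e = s(a₃, x) ∧ Unmarked o a₁ a₂ a₃ b x := by
  unfold A3RECM.A3ToMarks at h
  push Not at h
  obtain ⟨e, he, z, hz, hzo, hz1, hz2, hz3, hzb⟩ := h
  refine ⟨e, z, ?_, hzo, hz1, hz2, hz3, hzb⟩
  exact (Sym2.mem_and_mem_iff (Ne.symm hz3)).1 ⟨he, hz⟩

omit [Fintype E] [DecidableEq E] [DecidableEq V] in
/-- Two distinct unmarked vertices carry a non-loop edge on any instance outside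
`OneActiveUnmarked`. -/
theorem exists_two_active_of_not_oneActiveUnmarked {ends : E → Sym2 V} {o a₁ a₂ a₃ b : V}
    (h : ¬ OneActiveUnmarked ends o a₁ a₂ a₃ b) :
    ∃ x y : V, x ≠ y ∧ Unmarked o a₁ a₂ a₃ b x ∧ Unmarked o a₁ a₂ a₃ b y ∧
      (∃ e, x ∈ ends e ∧ ¬ (ends e).IsDiag) ∧ (∃ e, y ∈ ends e ∧ ¬ (ends e).IsDiag) := by
  unfold OneActiveUnmarked at h
  push Not at h
  obtain ⟨x, y, hx, hy, hex, hey, hxy⟩ := h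
  exact ⟨x, y, hxy, hx, hy, hex, hey⟩

/-- **THE SHAPE OF THE CLASS OF RECORD IN ONE STATEMENT.** -/
theorem shape_of_wredMinHAZ {ends : E → Sym2 V} {o a₁ a₂ a₃ b : V}
    (h : WReducedMinHAZ ends o a₁ a₂ a₃ b)
    (h12 : a₁ ≠ a₂) (h13 : a₁ ≠ a₃) (h23 : a₂ ≠ a₃) (ho1 : o ≠ a₁) (ho2 : o ≠ a₂) (ho3 : o ≠ a₃)
    (hob : o ≠ b) (hb1 : b ≠ a₁) (hb2 : b ≠ a₂) (hb3 : b ≠ a₃) :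
    Simple ends ∧
    (∀ y, Unmarked o a₁ a₂ a₃ b y → nonLoopDeg ends y = 0 ∨ 3 ≤ nonLoopDeg ends y) ∧
    (nonLoopDeg ends o ≠ 1 ∧ nonLoopDeg ends b ≠ 1 ∧ nonLoopDeg ends a₁ ≠ 1 ∧
      nonLoopDeg ends a₂ ≠ 1) ∧
    (¬ IsolatedMark.IsIsolated ends a₁ ∧ ¬ IsolatedMark.IsIsolated ends a₂ ∧
      ¬ IsolatedMark.IsIsolated ends o ∧ ¬ IsolatedMark.IsIsolated ends b) ∧
    (∀ v x y : V, x ≠ v → y ≠ v → x ≠ a₃ → y ≠ a₃ → (∃ e, x ∈ ends e ∧ ¬ (ends e).IsDiag) →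
      (∃ e, y ∈ ends e ∧ ¬ (ends e).IsDiag) → Conn ends (sepConfig ends {v}) x y) ∧
    MarksReach ends o a₁ a₂ a₃ b ∧
    (∀ (W : Set V) (u v : V), Block.IsBlock ends W u v → (∀ y ∈ W, Unmarked o a₁ a₂ a₃ b y) →
      ∀ y ∈ W, nonLoopDeg ends y = 0) ∧
    (∃ (e : E) (x : V), ends e = s(o, x) ∧ x ≠ o ∧ x ≠ a₁ ∧ x ≠ a₂ ∧ x ≠ b) ∧
    (∃ (e : E) (x : V), ends e = s(o, x) ∧ x ≠ o ∧ x ≠ a₃ ∧ x ≠ b) ∧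
    (∃ (e : E) (x : V), ends e = s(b, x) ∧ x ≠ b ∧ x ≠ a₁ ∧ x ≠ a₂ ∧ x ≠ o) ∧
    (∃ (e : E) (x : V), (ends e = s(o, x) ∨ ends e = s(b, x)) ∧ Unmarked o a₁ a₂ a₃ b x) ∧
    (∃ (e : E) (x : V), ends e = s(a₃, x) ∧ Unmarked o a₁ a₂ a₃ b x) ∧
    (∃ x y : V, x ≠ y ∧ Unmarked o a₁ a₂ a₃ b x ∧ Unmarked o a₁ a₂ a₃ b y ∧
      (∃ e, x ∈ ends e ∧ ¬ (ends e).IsDiag) ∧ (∃ e, y ∈ ends e ∧ ¬ (ends e).IsDiag)) ∧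
    (∀ e, ends e ≠ s(a₁, a₂) ∧ ends e ≠ s(a₁, a₃) ∧ ends e ≠ s(a₂, a₃)) := by
  have hMinH : WReducedMinH ends o a₁ a₂ a₃ b := h.toWReducedMinH
  have hMinOB : WReducedMinOB ends o a₁ a₂ a₃ b := hMinH.toWReducedMinOB
  have hMin : WReducedMin ends o a₁ a₂ a₃ b := hMinOB.toWReducedMin
  have hT : WReducedT ends o a₁ a₂ a₃ b := wredT_iff_wredMin.2 hMin
  have hOB : WReducedOB ends o a₁ a₂ a₃ b := wredOB_iff_wredMinOB.2 hMinOB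
  have hH : WReducedH ends o a₁ a₂ a₃ b := wredH_iff_wredMinH.2 hMinH
  obtain ⟨hs, hdeg, hleaves, hconn, hreach, hblk⟩ :=
    shape_of_wredT hT h12 h13 h23 ho1 ho2 ho3 hob hb1 hb2 hb3
  exact ⟨hs, hdeg, hleaves, ⟨hMin.notIso_a1, hMin.notIso_a2, hMin.notIso_o, hMin.notIso_b⟩,
    hconn, hreach, hblk, exists_o_edge_off_of_wredO hOB.toWReducedO,
    exists_o_edge_off_a3b_of_wredOB hOB, exists_b_edge_off_of_wredOB hOB,
    exists_pole_edge_off_of_wredH hH, exists_unmarked_neighbour_a3_of_not_a3ToMarks hMin.notR3,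
    exists_two_active_of_not_oneActiveUnmarked h.twoActive, roots_nonadjacent_of_wredMinHAZ h⟩

end Shape

end WRed

end Summit.Ventures.PercRepro2
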